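import Literature.MathematicalPhysics.QuantumFieldTheory.Balaban1983to89.Node00.OpsYRead342Pair

/-!
# NODE 00 — the TWO-MEMBER SITE-KERNEL readers `siteKernelOfOp₂` ∕ `siteKernelS₂Y` ∕ `idxKernelS₂Y` (the `Ksite` ∕ `Kunit` slots of N15's `NE2Objects₁₁`)

[B9] = Bałaban, *Propagators for lattice gauge theories in a background field*, CMP 99 (1985) 389–434; [K] = King, *The U(1) Higgs model. I. The continuum
limit*, CMP 102 (1986) 649–677 (the η-rate convention p.664, Prop. 3.9 (3.73) p.665, Lemma 4.5 (4.38) p.674, as typed in `T4EtaRate`).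

THE OBJECT (dag-n15-a g22's INTENT-RK ∕ QUESTION, fleet bus l.36272; this seat's INTENT-44, l.≈36440).  N15's objects at the record (`Node00.RateRecord11.NE2Objects₁₁`,
dag-n15-a's `ne2ObjectsOfRecordY`, p627101) carry, next to the operator-layer η-difference family `Kop` (= this seat's `Node00.OpsYRead342Pair.kernelFamilyS₂Y`, FILE 43),
two `B9.SiteKernel (pi i).gc (pi i).Bf` slots: `Ksite` — the η-difference of the SITE KERNELS of (3.48) (and, at exponent `p = 2`, of (3.132)) — and `Kunit` — the
η-difference of the unit-lattice kernels C^{(k)}(y, y′) of (3.187) ([K] Lemma 4.5 (4.38): «|C^{(k)}(x, y) − C^{(k+n)}(x, y)| ≤ CL^{−k}e^{−δ₀|x−y|}»).  The ONE-member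
reading of all three kernels is def-Y's `Node00.OpsYOfLetters.siteKernelOfOp i B cfg O ix iy` (`ker U b b′ = sup_{‖E‖ ≤ 1} ‖(O(cfg U)(δ_{iy b′} ⊗ E))(ix b)‖`; record
readings `operatorLayerYOfLetters_Cinv ∕ _Ck` through the blocks `β`, `_QGQinv ∕ _QG1Qinv` through the index bonds `id`).  THIS FILE types the two-member reader
over MODULE A's pairing (`refineK ∕ refineY`, `ιK ∕ ιY`) exactly as FILE 43 did for the operator layer:
* §1 (MODULE A's embedding on the UNIT lattice) ★ `inΛY_ιY_iff : inΛY x⁺ (ι y) ↔ inΛY x y` (Thm 3.15's region predicate is preserved — `Λ⁺ = (x′ ↦ x)⁻¹Λ` and `Λ` is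
  a union of big `k`-blocks) and ★ `kLab_ιY : inΛY x y → kLab x⁺ (ι y) = kLab x y` (the unit-lattice label of a region site is unchanged), from the index-generic
  `iterBlockOf_coarsenSite_baseSite_idxUp` ∕ `blk_bigSide_… ∕ blk_pow_toBox_baseSite_idxUp` (the step inside MODULE A's `beta_idxUp`, `blk_toBox`, `blk_blk`);
* §2 (index level) ★ `siteKernelOfOp₂ i n B cfgf cfgc Of Oc ixf iyf ixc iyc : B9.SiteKernel (geo9K i) B` —
  `ker U′ y y′ = sup_{‖E‖ ≤ 1} ‖(O⁺(cfgf U′)(δ_{iyf (ι y′)} ⊗ E))(ixf (ι y)) − (O(cfgc U′)(δ_{iyc y′} ⊗ E))(ixc y)‖`: FINE backgrounds `B`, run B's configuration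
  `cfgf`, run A's `cfgc` (at the record the n-fold average — a PARAMETER), the SAME amplitude `E` in both members; NO η-powers inside (the majorants (3.48) ∕ (3.132) ∕
  (3.187) are in physical lengths, and `len_ιY`, `dist_ιY` are equalities); the real-basis device `norm_apply_deltaY_le_of_repr` ∕ `bddAbove_norm_apply_deltaY`
  (FILE 41's `liftY` device for `δ_w ⊗ E`), the member domination `norm_apply_deltaY_le_siteKernelOfOp_ker`, and ★ the triangle
  inequality `siteKernelOfOp₂_ker_le_add`: `ker₂ U′ y y′ ≤ ker⁺ U′ (ι y) (ι y′) + ker U′ y y′`;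
* §3 (member level, `x⁺ = refineY x n`) ★ `siteKernelS₂Y G x n avg Of Oc : B9.SiteKernel (geo9Y x) (bg9Y 𝔸 G x⁺)` for BLOCK letters (`Ksite`: `Of ∕ Oc :=` the `C`
  letters of the two members' `CovLettersY`, (3.48); `Kunit`: their `Ck` letters, (3.187)) and ★ `idxKernelS₂Y G x n avg Of Oc` for INDEX-BOND letters (`QGQinv ∕
  QG1Qinv`, (3.132)); rfl faces, and `siteKernelOfOp_ker_avg` (the coarse member read over fine backgrounds through `avg` IS its record reading at `avg U′`);
* §4 the γ = 0 ∕ θ = 1 FLOOR faces: `etaRateIneqSite_zero_iff` (N15's `EtaRateIneqSite … γ = 0` = the plain majorant), ★★ `etaRateIneqSite_zero_siteKernelS₂Y_of_bounds`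
  ∕ `…_idxKernelS₂Y_of_bounds` — the (3.48)-shaped majorant with `(C₁, δ)` for the fine member at `U′` AND with `(C₂, δ)` for the coarse member at `avg U′` give
  `EtaRateIneqSite dB p (siteKernelS₂Y …) (C₁ + C₂) δ 0 U′` ([B9] Thm 3.2 twice and the triangle inequality; the η-GAIN `γ > 0` is N15's content, NOT asserted), and
  ★ `etaRateIneqUnit_one_siteKernelS₂Y_of_bounds` — the (3.187)-shaped unit-lattice majorants of the two members give `EtaRateIneqUnit … B₁ + B₂) δ₀ 1 k U′`
  (`θ = 1`: no gain), the region transfer being §1's `inΛY_ιY_iff` and the distance transfer `unitDistY x y y′ ≤ unitDistY x⁺ (ι y) (ι y′)` on `Λ` carried as the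
  HYPOTHESIS `hD` — NOT SUPPLIED here: by `kLab_ιY` both sides are torus sup-distances of the SAME labels, on `T^{(k+n)}` (periods `Lⁿ·N0`, unit `L^{k+n}`) resp.
  `T^{(k)}` (periods `N0`, unit `L^k`), and their equality is the homogeneity of the `AddCircle` metric under `Lⁿ` (`tdistK`; a successor item).
HONEST SCOPE.  OBJECTS and sup ∕ triangle-inequality bookkeeping over def-Y's definitions; η-DIFFERENCE statements are NOT PRINTED in [B9] (`T4EtaRate` GAPS
G-t4-U1a-1 ∕ 2); the n-fold average `avg` is NOT constructed (a parameter); the record's unit-lattice LETTER C̃^{(k)} (`CovLettersY.Ck`) is a parameter of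
`lettersYOfRecord` (residual, `OpsYRecordV5`); nothing of [B9] Thm 3.2 ∕ (3.132) ∕ Thm 3.15 or of [K] Prop. 3.9 ∕ Lemma 4.5 or of NE2⁺ asserted; the floor faces
carry `Node00.OpsYRead342`'s real-basis hypotheses (`b`, `hrepr`) verbatim; COUNT-NEUTRAL; N15 ∕ N06 NOT discharged; one finite 𝕋⁴ programme at fixed ε —
nothing continuum, nothing about the mass gap.  Cell `pub-ymgap` (HUMAN RULING D-0062), Track A nodes N06 [B9] ∕ N15, seat `pub-ymgap-node00-def-Y` (g22), 2026-08-28.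
-/

namespace Literature.MathematicalPhysics.QuantumFieldTheory.Balaban1983to89.Node00.OpsYSiteKernelPair

open B4Reflection242 (blk)
open B4Thm110ZeroBox (blk_blk)
open B5Eq118OneStroke (iterBlockOf)
open B6MultiLevelBoxOperator (N0 bigSide bigSide_eq)
open B6MultiLevelTorusOperator (TDomains)
open B6GlobalChartV1 (PV toBox domT blk_toBox)
open B6SectAOperatorsV1 (BondIdx)
open B6Ineq2142KLevelV1 (β lvl base baseSite iterBlockOf_baseSite lvl_le_mK)
open B6KLevelCensusIndexV1 (KIdx)
open B9GeoNormsKLevelV1 (geo9K)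
open B9PinMembersKLevelV1 (MemberY geo9Y bg9Y)
open B9PinGeometryKLevelV1 (inΛY unitDistY kLab)
open Node00.MemberYRefineDomains (refineT coarsen_val)
open Node00.MemberYRefine (hN_refine hk_refine coarsenSite toBox_coarsenSite idxUp cast_base_idxUp iterBlockOf_coarsenSite refineK refineY ιY
  dist_ιY len_ιY)
open Node00.OpsYRead342Pair (ιK)
open T4EtaRate (EtaRateIneqSite EtaRateIneqUnit rateFactor)

noncomputable section

variable {d ℓ : ℕ} {hd : 1 ≤ d + 1} {hL : Odd (ℓ + 1) ∧ 1 < ℓ + 1} {b₀ b₁ : ℝ} {Mstar : ℕ}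
variable {𝔸 : Type} [NormedRing 𝔸] [NormedAlgebra ℂ 𝔸] [CompleteSpace 𝔸]

/-! ## §1 MODULE A's embedding on the unit lattice: `ι y ∈ Λ⁺ ↔ y ∈ Λ` and the `k`-block labels `kLab⁺ (ι y) = kLab y` -/

section UnitLattice

variable {m K Mh k R : ℕ} {P' : Fin (d + 1) → ℕ} (hN : ∀ μ, N0 ℓ Mh k P' μ = (PV d ℓ m K hd hL).sitesPerDir 0)
  (D : TDomains d ℓ Mh k P' R) (hk : k ≤ m + K) (n : ℕ)

/-- the coarsening of the embedded bond's chosen base site lies in the base block: `y^{j}(x′ ↦ x) = base c` for `x′ = baseSite⁺ (ι c)` (the step inside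
MODULE A's `beta_idxUp`). [cite: King1986, p.664 («x′ ∈ Bⁿ(x)»); Balaban1984PropagatorsII, (2.3) p.224, bookkeeping] -/
theorem iterBlockOf_coarsenSite_baseSite_idxUp (c : BondIdx (domT hN D hk)) :
    iterBlockOf (lvl hN D hk c) (coarsenSite n (baseSite (hN_refine hN n) (refineT D n) (hk_refine hk n) (idxUp hN D hk n c))) = base hN D hk c := by
  rw [iterBlockOf_coarsenSite (lvl_le_mK hN D hk c), ← cast_base_idxUp hN D hk n c]
  exact congrArg _ (iterBlockOf_baseSite (hN_refine hN n) (refineT D n) (hk_refine hk n) (idxUp hN D hk n c))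

/-- for a TOP-level bond (`j(c) = k`) the coarsened base site of `ι c` and the base site of `c` lie in the same `k`-block. [cite: King1986, p.664; Balaban1984PropagatorsI, (1.18) p.20, bookkeeping] -/
theorem iterBlockOf_k_coarsenSite_baseSite_idxUp (c : BondIdx (domT hN D hk)) (h : lvl hN D hk c = k) :
    iterBlockOf k (coarsenSite n (baseSite (hN_refine hN n) (refineT D n) (hk_refine hk n) (idxUp hN D hk n c))) = iterBlockOf k (baseSite hN D hk c) := by
  have aux : ∀ j, j = lvl hN D hk c →
      iterBlockOf j (coarsenSite n (baseSite (hN_refine hN n) (refineT D n) (hk_refine hk n) (idxUp hN D hk n c))) = iterBlockOf j (baseSite hN D hk c) := by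
    rintro j rfl
    rw [iterBlockOf_coarsenSite_baseSite_idxUp, iterBlockOf_baseSite]
  exact aux k h.symm

/-- … hence they carry the same BIG-`k`-block label (the saturation class of a member's `Λ`, `MemberY.hΛblocks`). [cite: Balaban1985BackgroundPropagators, Thm 3.15 p.432 («Λ ⊂ Λ_k a union of big blocks»); King1986, p.664, bookkeeping] -/
theorem blk_bigSide_coarsenSite_baseSite_idxUp (c : BondIdx (domT hN D hk)) (h : lvl hN D hk c = k) :
    blk (bigSide ℓ Mh k) (toBox hN (coarsenSite n (baseSite (hN_refine hN n) (refineT D n) (hk_refine hk n) (idxUp hN D hk n c)))).1 =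
      blk (bigSide ℓ Mh k) (toBox hN (baseSite hN D hk c)).1 := by
  have e : ∀ z : Fin (d + 1) → ℤ, blk (bigSide ℓ Mh k) z = blk (Mh * (ℓ + 1)) (blk ((ℓ + 1) ^ k) z) := fun z => by
    rw [bigSide_eq, blk_blk]
  rw [e, e, blk_toBox hN hk, blk_toBox hN hk, iterBlockOf_k_coarsenSite_baseSite_idxUp hN D hk n c h]

/-- … and the same UNIT-LATTICE label: `blk (L^{k+n}) (toBox⁺ (baseSite⁺ (ι c))) = blk (L^k) (toBox (baseSite c))` — the point of `T₁^{(k)}` a top-level site names is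
unchanged by the embedding. [cite: Balaban1985BackgroundPropagators, Thm 3.15 (3.187) p.432 («y, y′ ∈ Λ» points of `T₁^{(k)}`); King1986, p.664, bookkeeping] -/
theorem blk_pow_toBox_baseSite_idxUp (c : BondIdx (domT hN D hk)) (h : lvl hN D hk c = k) :
    blk ((ℓ + 1) ^ (k + n)) (toBox (hN_refine hN n) (baseSite (hN_refine hN n) (refineT D n) (hk_refine hk n) (idxUp hN D hk n c))).1 =
      blk ((ℓ + 1) ^ k) (toBox hN (baseSite hN D hk c)).1 := by
  have e : ∀ z : Fin (d + 1) → ℤ, blk ((ℓ + 1) ^ (k + n)) z = blk ((ℓ + 1) ^ k) (blk ((ℓ + 1) ^ n) z) := fun z => by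
    rw [blk_blk, ← pow_add, Nat.add_comm n k]
  rw [e, ← coarsen_val, ← toBox_coarsenSite hN n, blk_toBox hN hk, blk_toBox hN hk, iterBlockOf_k_coarsenSite_baseSite_idxUp hN D hk n c h]

end UnitLattice

section UnitLatticeMember

variable (x : MemberY d ℓ hd hL b₀ b₁ Mstar) (n : ℕ)

/-- ★ **`ι y ∈ Λ⁺ ↔ y ∈ Λ`**: MODULE A's site embedding preserves Thm 3.15's region predicate (`Λ⁺ = (x′ ↦ x)⁻¹Λ`, `mem_Λ_refineY`; `Λ` is a union of big `k`-blocks).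
[cite: Balaban1985BackgroundPropagators, Thm 3.15 (3.187) p.432 («y, y′ ∈ Λ»); King1986, p.664 (the pairing convention)] -/
theorem inΛY_ιY_iff (c : (geo9Y x).Site) : inΛY (refineY x n) (ιY x n c) ↔ inΛY x c := by
  constructor
  · rintro ⟨hl, hb⟩
    have hk : lvl x.hN x.D x.hk c = x.k := by
      have hl' : lvl x.hN x.D x.hk c + n = x.k + n := hl
      omega
    exact ⟨hk, (x.hΛblocks _ _ (blk_bigSide_coarsenSite_baseSite_idxUp x.hN x.D x.hk n c hk)).2 hb⟩
  · rintro ⟨hk, hb⟩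
    have hl : lvl x.hN x.D x.hk c + n = x.k + n := by rw [hk]
    exact ⟨hl, (x.hΛblocks _ _ (blk_bigSide_coarsenSite_baseSite_idxUp x.hN x.D x.hk n c hk)).1 hb⟩

/-- ★ **`kLab⁺ (ι y) = kLab y` on `Λ`**: the unit-lattice point of an embedded region site is that of the site (so `unitDistY x⁺ (ι y) (ι y′)` and `unitDistY x y y′`
are the torus distances of the SAME labels, on `T^{(k+n)}` of run B resp. `T^{(k)}` of run A — their equality is the torus-metric homogeneity, NOT supplied here).
[cite: Balaban1985BackgroundPropagators, Thm 3.15 (3.187) p.432 («|y − y′|»); King1986, p.664, Lemma 4.5 (4.38) p.674] -/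
theorem kLab_ιY {c : (geo9Y x).Site} (h : inΛY x c) : kLab (refineY x n) (ιY x n c) = kLab x c :=
  blk_pow_toBox_baseSite_idxUp x.hN x.D x.hk n c h.1

end UnitLatticeMember

/-! ## §2 The real-basis device for `δ_w ⊗ E`, the member domination, and the two-member site-kernel reader at an index -/

section Device

variable {ι : Type} [Fintype ι] (b : Module.Basis ι ℝ 𝔸)

omit [CompleteSpace 𝔸] in
/-- ★ a UNIFORM bound over the unit ball of a ℂ-linear image of the amplitudes `δ_w ⊗ E`, from a coordinate bound `|repr_j v| ≤ M₂‖v‖`: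
`‖(O(δ_w ⊗ E))(z)‖ ≤ M₂·Σ_j ‖(O(δ_w ⊗ b_j))(z)‖` (`‖E‖ ≤ 1`; the decomposition `δ_w ⊗ E = Σ_j (repr_j E)·(δ_w ⊗ b_j)` is n06's
`B9CubeLettersInvReadDict.deltaY_eq_sum_repr`, FILE 41's `liftY_eq_sum_repr` for `δ_w`). [cite: Balaban1985BackgroundPropagators, (3.48) p.398 (sup over the amplitude), bookkeeping] -/
theorem norm_apply_deltaY_le_of_repr {X Y : Type} (O : (Y → 𝔸) →ₗ[ℂ] (X → 𝔸)) {M₂ : ℝ} (hM₂ : 0 ≤ M₂)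
    (hrepr : ∀ (v : 𝔸) (j : ι), |b.repr v j| ≤ M₂ * ‖v‖) (w : Y) {E : 𝔸} (hE : ‖E‖ ≤ 1) (z : X) :
    ‖O (deltaY w E) z‖ ≤ M₂ * ∑ j, ‖O (deltaY w (b j)) z‖ := by
  have hΔ : deltaY w E = ∑ j, (b.repr E j) • deltaY w (b j) := by  -- `B9CubeLettersInvReadDict.deltaY_eq_sum_repr` (n06's cone; not imported here)
    funext z
    rw [Finset.sum_apply]
    simp only [deltaY, Pi.smul_apply]
    split_ifs with h
    · exact (b.sum_repr E).symm
    · simp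
  have hsum : O (deltaY w E) = ∑ j, (b.repr E j) • O (deltaY w (b j)) := by
    rw [hΔ, map_sum]
    exact Finset.sum_congr rfl fun j _ => LinearMap.map_smul_of_tower O (b.repr E j) _
  rw [hsum, Finset.sum_apply, Finset.mul_sum]
  refine (norm_sum_le _ _).trans (Finset.sum_le_sum fun j _ => ?_)
  rw [Pi.smul_apply, norm_smul, Real.norm_eq_abs]
  exact mul_le_mul_of_nonneg_right ((hrepr E j).trans (mul_le_of_le_one_right hM₂ hE)) (norm_nonneg _)

/-- the sup over the unit ball of `‖(O(δ_w ⊗ E))(z)‖` is over a BOUNDED set (so it dominates its members). [cite: Balaban1985BackgroundPropagators, (3.48) p.398, bookkeeping] -/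
theorem bddAbove_norm_apply_deltaY {X Y : Type} (O : (Y → 𝔸) →ₗ[ℂ] (X → 𝔸)) {M₂ : ℝ} (hM₂ : 0 ≤ M₂)
    (hrepr : ∀ (v : 𝔸) (j : ι), |b.repr v j| ≤ M₂ * ‖v‖) (w : Y) (z : X) :
    BddAbove (Set.range fun E : BallY 𝔸 => ‖O (deltaY w (E : 𝔸)) z‖) :=
  ⟨M₂ * ∑ j, ‖O (deltaY w (b j)) z‖, by
    rintro _ ⟨E, rfl⟩
    exact norm_apply_deltaY_le_of_repr b O hM₂ hrepr w (mem_closedBall_zero_iff.1 E.2) z⟩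

end Device

section Index

variable (i : KIdx d ℓ hd hL b₀ b₁) (n : ℕ)

/-- each member `‖(O(cfg U)(δ_{iy c′} ⊗ E))(ix c)‖` of a BOUNDED reading is dominated by the one-member site kernel `siteKernelOfOp`.
[cite: Balaban1985BackgroundPropagators, (3.48) p.398, (3.132) p.422, (3.187) p.432 (the kernels), bookkeeping] -/
theorem norm_apply_deltaY_le_siteKernelOfOp_ker (B : B9.Backgrounds) (cfg : B.Cfg → CfgY 𝔸 i) {X Y : Type}
    (O : CfgY 𝔸 i → (Y → 𝔸) →ₗ[ℂ] (X → 𝔸)) (ix : IBondY i → X) (iy : IBondY i → Y) (U : B.Cfg) (c c' : IBondY i)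
    (hbdd : BddAbove (Set.range fun E : BallY 𝔸 => ‖O (cfg U) (deltaY (iy c') (E : 𝔸)) (ix c)‖)) (E : BallY 𝔸) :
    ‖O (cfg U) (deltaY (iy c') (E : 𝔸)) (ix c)‖ ≤ (siteKernelOfOp i B cfg O ix iy).ker U c c' :=
  le_ciSup (f := fun E : BallY 𝔸 => ‖O (cfg U) (deltaY (iy c') (E : 𝔸)) (ix c)‖) hbdd E

/-- ★ **THE TWO-MEMBER SITE-KERNEL READER** («run B at η′ = L^{−n}η against run A at η»): over FINE backgrounds `B` (run B's configuration `cfgf`, run A's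
`cfgc` — at the record the n-fold average, a PARAMETER), the η-difference kernel
`ker U′ y y′ = sup_{‖E‖ ≤ 1} ‖(O⁺(cfgf U′)(δ_{iyf (ι y′)} ⊗ E))(ixf (ι y)) − (O(cfgc U′)(δ_{iyc y′} ⊗ E))(ixc y)‖`, the coarse sites embedded by `ι = ιK i n`
([K] p.664), the SAME amplitude `E` in both members, the coarse points read through `ixf ∕ iyf` (fine member) and `ixc ∕ iyc` (coarse member).  HYPOTHESIS-SHAPE
OBJECT: η-differences of [B9]'s kernels are NOT PRINTED ([K] (3.73) ∕ (4.38) are the U(1), A = 0 templates).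
[cite: King1986, p.664 (pairing convention), Prop. 3.9 (3.73) p.665, Lemma 4.5 (4.38) p.674; Balaban1985BackgroundPropagators, (3.48) p.398, (3.132) p.422, (3.187) p.432 (the kernels differenced)] -/
def siteKernelOfOp₂ (B : B9.Backgrounds) (cfgf : B.Cfg → CfgY 𝔸 (refineK i n)) (cfgc : B.Cfg → CfgY 𝔸 i) {Xf Yf Xc Yc : Type}
    (Of : CfgY 𝔸 (refineK i n) → (Yf → 𝔸) →ₗ[ℂ] (Xf → 𝔸)) (Oc : CfgY 𝔸 i → (Yc → 𝔸) →ₗ[ℂ] (Xc → 𝔸))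
    (ixf : IBondY (refineK i n) → Xf) (iyf : IBondY (refineK i n) → Yf) (ixc : IBondY i → Xc) (iyc : IBondY i → Yc) :
    B9.SiteKernel (geo9K i) B :=
  ⟨fun U' c c' => ⨆ E : BallY 𝔸,
    ‖Of (cfgf U') (deltaY (iyf (ιK i n c')) (E : 𝔸)) (ixf (ιK i n c)) - Oc (cfgc U') (deltaY (iyc c') (E : 𝔸)) (ixc c)‖⟩

variable (B : B9.Backgrounds) (cfgf : B.Cfg → CfgY 𝔸 (refineK i n)) (cfgc : B.Cfg → CfgY 𝔸 i) {Xf Yf Xc Yc : Type}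
  (Of : CfgY 𝔸 (refineK i n) → (Yf → 𝔸) →ₗ[ℂ] (Xf → 𝔸)) (Oc : CfgY 𝔸 i → (Yc → 𝔸) →ₗ[ℂ] (Xc → 𝔸))
  (ixf : IBondY (refineK i n) → Xf) (iyf : IBondY (refineK i n) → Yf) (ixc : IBondY i → Xc) (iyc : IBondY i → Yc)

/-- the two-member kernel, unfolded. [cite: King1986, Prop. 3.9 (3.73) p.665 (shape); Balaban1985BackgroundPropagators, (3.48) p.398] -/
theorem siteKernelOfOp₂_ker (U' : B.Cfg) (c c' : IBondY i) :
    (siteKernelOfOp₂ i n B cfgf cfgc Of Oc ixf iyf ixc iyc).ker U' c c' =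
      ⨆ E : BallY 𝔸, ‖Of (cfgf U') (deltaY (iyf (ιK i n c')) (E : 𝔸)) (ixf (ιK i n c)) - Oc (cfgc U') (deltaY (iyc c') (E : 𝔸)) (ixc c)‖ := rfl

/-- the two-member kernel is non-negative (a sup of norms). [cite: Balaban1985BackgroundPropagators, (3.48) p.398, bookkeeping] -/
theorem siteKernelOfOp₂_ker_nonneg (U' : B.Cfg) (c c' : IBondY i) : 0 ≤ (siteKernelOfOp₂ i n B cfgf cfgc Of Oc ixf iyf ixc iyc).ker U' c c' :=
  Real.iSup_nonneg fun _ => norm_nonneg _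

/-- `|ker₂| = ker₂`. [cite: Balaban1985BackgroundPropagators, (3.48) p.398, bookkeeping] -/
theorem abs_siteKernelOfOp₂_ker (U' : B.Cfg) (c c' : IBondY i) :
    |(siteKernelOfOp₂ i n B cfgf cfgc Of Oc ixf iyf ixc iyc).ker U' c c'| = (siteKernelOfOp₂ i n B cfgf cfgc Of Oc ixf iyf ixc iyc).ker U' c c' :=
  abs_of_nonneg (siteKernelOfOp₂_ker_nonneg i n B cfgf cfgc Of Oc ixf iyf ixc iyc U' c c')

/-- the triangle inequality, pointwise form: amplitude-wise bounds `M₁` (fine member at `(ι y, ι y′)`) and `M₂` (coarse member at `(y, y′)`) give `ker₂ ≤ M₁ + M₂`.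
[cite: King1986, Prop. 3.9 p.665 (the difference); Balaban1985BackgroundPropagators, (3.48) p.398, bookkeeping] -/
theorem siteKernelOfOp₂_ker_le_of_pointwise (U' : B.Cfg) (c c' : IBondY i) {M₁ M₂ : ℝ} (hM₁ : 0 ≤ M₁) (hM₂ : 0 ≤ M₂)
    (h₁ : ∀ E : BallY 𝔸, ‖Of (cfgf U') (deltaY (iyf (ιK i n c')) (E : 𝔸)) (ixf (ιK i n c))‖ ≤ M₁)
    (h₂ : ∀ E : BallY 𝔸, ‖Oc (cfgc U') (deltaY (iyc c') (E : 𝔸)) (ixc c)‖ ≤ M₂) :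
    (siteKernelOfOp₂ i n B cfgf cfgc Of Oc ixf iyf ixc iyc).ker U' c c' ≤ M₁ + M₂ :=
  Real.iSup_le (fun E => (norm_sub_le _ _).trans (add_le_add (h₁ E) (h₂ E))) (add_nonneg hM₁ hM₂)

/-- ★ **THE TRIANGLE INEQUALITY OF THE PAIR READER**: `ker₂ U′ y y′ ≤ ker⁺ U′ (ι y) (ι y′) + ker U′ y y′` — the two-member kernel is dominated by the fine member's
one-member kernel at the embedded sites plus the coarse member's (both `siteKernelOfOp`, over the same fine backgrounds), once both readings are bounded.
[cite: King1986, Prop. 3.9 (3.73) p.665, Lemma 4.5 (4.38) p.674 (the differences); Balaban1985BackgroundPropagators, (3.48) p.398, (3.132) p.422, (3.187) p.432] -/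
theorem siteKernelOfOp₂_ker_le_add (U' : B.Cfg) (c c' : IBondY i)
    (hbdf : BddAbove (Set.range fun E : BallY 𝔸 => ‖Of (cfgf U') (deltaY (iyf (ιK i n c')) (E : 𝔸)) (ixf (ιK i n c))‖))
    (hbdc : BddAbove (Set.range fun E : BallY 𝔸 => ‖Oc (cfgc U') (deltaY (iyc c') (E : 𝔸)) (ixc c)‖)) :
    (siteKernelOfOp₂ i n B cfgf cfgc Of Oc ixf iyf ixc iyc).ker U' c c' ≤
      (siteKernelOfOp (refineK i n) B cfgf Of ixf iyf).ker U' (ιK i n c) (ιK i n c') + (siteKernelOfOp i B cfgc Oc ixc iyc).ker U' c c' :=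
  Real.iSup_le
    (fun E => (norm_sub_le _ _).trans (add_le_add
      (norm_apply_deltaY_le_siteKernelOfOp_ker (refineK i n) B cfgf Of ixf iyf U' (ιK i n c) (ιK i n c') hbdf E)
      (norm_apply_deltaY_le_siteKernelOfOp_ker i B cfgc Oc ixc iyc U' c c' hbdc E)))
    (add_nonneg (Real.iSup_nonneg fun _ => norm_nonneg _) (Real.iSup_nonneg fun _ => norm_nonneg _))

/-- the triangle inequality under the real-basis device (both readings bounded by `bddAbove_norm_apply_deltaY`). [cite: King1986, Prop. 3.9 (3.73) p.665; Balaban1985BackgroundPropagators, (3.48) p.398, bookkeeping] -/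
theorem siteKernelOfOp₂_ker_le_add_of_repr {ι : Type} [Fintype ι] (b : Module.Basis ι ℝ 𝔸) {M₂ : ℝ} (hM₂ : 0 ≤ M₂)
    (hrepr : ∀ (v : 𝔸) (j : ι), |b.repr v j| ≤ M₂ * ‖v‖) (U' : B.Cfg) (c c' : IBondY i) :
    (siteKernelOfOp₂ i n B cfgf cfgc Of Oc ixf iyf ixc iyc).ker U' c c' ≤
      (siteKernelOfOp (refineK i n) B cfgf Of ixf iyf).ker U' (ιK i n c) (ιK i n c') + (siteKernelOfOp i B cfgc Oc ixc iyc).ker U' c c' :=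
  siteKernelOfOp₂_ker_le_add i n B cfgf cfgc Of Oc ixf iyf ixc iyc U' c c'
    (bddAbove_norm_apply_deltaY b (Of (cfgf U')) hM₂ hrepr _ _) (bddAbove_norm_apply_deltaY b (Oc (cfgc U')) hM₂ hrepr _ _)

end Index

/-! ## §3 At a member of record: `siteKernelS₂Y` (block letters, (3.48) ∕ (3.187)) and `idxKernelS₂Y` (index-bond letters, (3.132)) -/

section Member

variable (𝔸) (G : Subgroup 𝔸ˣ) (x : MemberY d ℓ hd hL b₀ b₁ Mstar) (n : ℕ)

/-- the type of a BLOCK letter at an index (`CovLettersY.C`, `.Ck`: operators on block functions). [cite: Balaban1985BackgroundPropagators, (3.48) p.398, (3.187) p.432, dictionary] -/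
abbrev BlkLetterY (i : KIdx d ℓ hd hL b₀ b₁) : Type := CfgY 𝔸 i → (BlkY i → 𝔸) →ₗ[ℂ] (BlkY i → 𝔸)

/-- the type of an INDEX-BOND letter at an index (`CovLettersY.QGQinv`, `.QG1Qinv`). [cite: Balaban1985BackgroundPropagators, (3.132) p.422, dictionary] -/
abbrev IdxLetterY (i : KIdx d ℓ hd hL b₀ b₁) : Type := CfgY 𝔸 i → (IBondY i → 𝔸) →ₗ[ℂ] (IBondY i → 𝔸)

variable {𝔸}
variable (avg : CfgY 𝔸 (refineY x n).toKIdx → CfgY 𝔸 x.toKIdx)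

/-- ★ **THE TWO-MEMBER SITE KERNEL AT A MEMBER OF RECORD, BLOCK LETTERS** (`x⁺ = refineY x n`, coarse geometry `geo9Y x`, FINE backgrounds `bg9Y 𝔸 G x⁺`, run B's
configuration `U′` itself, run A's `avg U′`): `Ksite` of `NE2Objects₁₁` is this reader at the two members' (3.48) letters `Of := 𝔏⁺.C`, `Oc := 𝔏.C`
(`𝔏⁺ = lettersYOfRecord … x⁺`, `𝔏 = lettersYOfRecord … x`; `operatorLayerYOfLetters_Cinv`), and `Kunit` is this SAME reader at their (3.187) letters `Of := 𝔏⁺.Ck`,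
`Oc := 𝔏.Ck` (`operatorLayerYOfLetters_Ck`; the record's C̃^{(k)} letter is a parameter of `lettersYOfRecord`).  `avg` is a PARAMETER (Bałaban's n-fold average is
not constructed here). [cite: King1986, p.664, Prop. 3.9 (3.73) p.665, Lemma 4.5 (4.38) p.674; Balaban1985BackgroundPropagators, Thm 3.2 (3.48) p.398, Thm 3.15 (3.187) p.432] -/
def siteKernelS₂Y (Of : BlkLetterY 𝔸 (refineY x n).toKIdx) (Oc : BlkLetterY 𝔸 x.toKIdx) : B9.SiteKernel (geo9Y x) (bg9Y 𝔸 G (refineY x n)) :=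
  siteKernelOfOp₂ x.toKIdx n (bg9Y 𝔸 G (refineY x n)) (fun U => U) avg Of Oc
    (β (refineY x n).hN (refineY x n).D (refineY x n).hk) (β (refineY x n).hN (refineY x n).D (refineY x n).hk) (β x.hN x.D x.hk) (β x.hN x.D x.hk)

/-- ★ **THE TWO-MEMBER SITE KERNEL AT A MEMBER OF RECORD, INDEX-BOND LETTERS** (the (3.132) kernels (QGQ*)⁻¹, (QG₁Q*)⁻¹ read through the index bonds
themselves: `Of := 𝔏⁺.QGQinv`, `Oc := 𝔏.QGQinv`, resp. `QG1Qinv`; `operatorLayerYOfLetters_QGQinv`). [cite: King1986, p.664, Prop. 3.9 (3.73) p.665; Balaban1985BackgroundPropagators, (3.132) p.422] -/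
def idxKernelS₂Y (Of : IdxLetterY 𝔸 (refineY x n).toKIdx) (Oc : IdxLetterY 𝔸 x.toKIdx) : B9.SiteKernel (geo9Y x) (bg9Y 𝔸 G (refineY x n)) :=
  siteKernelOfOp₂ x.toKIdx n (bg9Y 𝔸 G (refineY x n)) (fun U => U) avg Of Oc id id id id

/-- `siteKernelS₂Y` IS `siteKernelOfOp₂` at the blocks. [cite: Balaban1985BackgroundPropagators, (3.48) p.398, dictionary] -/
theorem siteKernelS₂Y_eq (Of : BlkLetterY 𝔸 (refineY x n).toKIdx) (Oc : BlkLetterY 𝔸 x.toKIdx) :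
    siteKernelS₂Y G x n avg Of Oc = siteKernelOfOp₂ x.toKIdx n (bg9Y 𝔸 G (refineY x n)) (fun U => U) avg Of Oc
      (β (refineY x n).hN (refineY x n).D (refineY x n).hk) (β (refineY x n).hN (refineY x n).D (refineY x n).hk) (β x.hN x.D x.hk) (β x.hN x.D x.hk) := rfl

/-- `idxKernelS₂Y` IS `siteKernelOfOp₂` at the index bonds. [cite: Balaban1985BackgroundPropagators, (3.132) p.422, dictionary] -/
theorem idxKernelS₂Y_eq (Of : IdxLetterY 𝔸 (refineY x n).toKIdx) (Oc : IdxLetterY 𝔸 x.toKIdx) :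
    idxKernelS₂Y G x n avg Of Oc = siteKernelOfOp₂ x.toKIdx n (bg9Y 𝔸 G (refineY x n)) (fun U => U) avg Of Oc id id id id := rfl

/-- the block-letter pair kernel, unfolded: `ker U′ y y′ = sup_E ‖(O⁺(U′)(δ_{Δ⁺(ι y′)} ⊗ E))(Δ⁺(ι y)) − (O(avg U′)(δ_{Δ(y′)} ⊗ E))(Δ(y))‖`.
[cite: King1986, Prop. 3.9 (3.73) p.665, Lemma 4.5 (4.38) p.674 (shape); Balaban1985BackgroundPropagators, (3.48) p.398, (3.187) p.432] -/
theorem siteKernelS₂Y_ker (Of : BlkLetterY 𝔸 (refineY x n).toKIdx) (Oc : BlkLetterY 𝔸 x.toKIdx) (U' : CfgY 𝔸 (refineY x n).toKIdx) (c c' : (geo9Y x).Site) :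
    (siteKernelS₂Y G x n avg Of Oc).ker U' c c' = ⨆ E : BallY 𝔸,
      ‖Of U' (deltaY (β (refineY x n).hN (refineY x n).D (refineY x n).hk (ιY x n c')) (E : 𝔸)) (β (refineY x n).hN (refineY x n).D (refineY x n).hk (ιY x n c)) -
        Oc (avg U') (deltaY (β x.hN x.D x.hk c') (E : 𝔸)) (β x.hN x.D x.hk c)‖ := rfl

/-- the index-bond pair kernel, unfolded: `ker U′ y y′ = sup_E ‖(O⁺(U′)(δ_{ι y′} ⊗ E))(ι y) − (O(avg U′)(δ_{y′} ⊗ E))(y)‖`.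
[cite: King1986, Prop. 3.9 (3.73) p.665 (shape); Balaban1985BackgroundPropagators, (3.132) p.422] -/
theorem idxKernelS₂Y_ker (Of : IdxLetterY 𝔸 (refineY x n).toKIdx) (Oc : IdxLetterY 𝔸 x.toKIdx) (U' : CfgY 𝔸 (refineY x n).toKIdx) (c c' : (geo9Y x).Site) :
    (idxKernelS₂Y G x n avg Of Oc).ker U' c c' = ⨆ E : BallY 𝔸,
      ‖Of U' (deltaY (ιY x n c') (E : 𝔸)) (ιY x n c) - Oc (avg U') (deltaY c' (E : 𝔸)) c‖ := rfl

/-- the coarse member's one-member reading over the FINE backgrounds through `avg` IS its record reading (`operatorLayerYOfLetters_Cinv ∕ _Ck ∕ _QGQinv`'s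
`siteKernelOfOp x.toKIdx (bg9Y 𝔸 G x) (fun U => U) …`) at `avg U′`. [cite: King1986, p.664 («G^{η}(avg U′)»); Balaban1985BackgroundPropagators, (3.48) p.398, dictionary] -/
theorem siteKernelOfOp_ker_avg {X Y : Type} (Oc : CfgY 𝔸 x.toKIdx → (Y → 𝔸) →ₗ[ℂ] (X → 𝔸)) (ix : IBondY x.toKIdx → X) (iy : IBondY x.toKIdx → Y)
    (U' : CfgY 𝔸 (refineY x n).toKIdx) :
    (siteKernelOfOp x.toKIdx (bg9Y 𝔸 G (refineY x n)) avg Oc ix iy).ker U' = (siteKernelOfOp x.toKIdx (bg9Y 𝔸 G x) (fun U => U) Oc ix iy).ker (avg U') := rfl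

end Member

/-! ## §4 The γ = 0 ∕ θ = 1 FLOOR faces: [B9]'s majorants for the two members and the triangle inequality (the η-gain is N15's, NOT asserted) -/

section Floor

variable {G : Subgroup 𝔸ˣ} {x : MemberY d ℓ hd hL b₀ b₁ Mstar} {n : ℕ} {avg : CfgY 𝔸 (refineY x n).toKIdx → CfgY 𝔸 x.toKIdx}
variable {ι : Type} [Fintype ι] (b : Module.Basis ι ℝ 𝔸) {M₂ : ℝ}

omit [CompleteSpace 𝔸] in
/-- at rate exponent `γ = 0` N15's site-kernel inequality IS the plain (3.48)-shaped majorant (the rate factor is `1`). [cite: Balaban1985BackgroundPropagators, Thm 3.2 (3.48) p.398; King1986, Prop. 3.9 (3.73) p.665 (γ = 0: no gain)] -/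
theorem etaRateIneqSite_zero_iff {g : B9.Geometry} {B' : B9.Backgrounds} (Kd : B9.SiteKernel g B') (dB : ℕ) (p C δ : ℝ) (U : B'.Cfg) :
    EtaRateIneqSite dB p Kd C δ 0 U ↔
      ∀ y y' : g.Site, |Kd.ker U y y'| ≤ C * g.len y ^ (-p) * g.len y' ^ (-(dB : ℝ)) * Real.exp (-(δ * g.dist y y')) := by
  simp only [EtaRateIneqSite, rateFactor, Real.rpow_zero, max_self, mul_one]

/-- the generic floor: for a pair reader `siteKernelOfOp₂ x.toKIdx n (bg9Y G x⁺) id avg Of Oc ixf iyf ixc iyc` whose members obey the (3.48)-shaped majorants with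
`(C₁, δ)` at `U′` (fine, in `geo9Y x⁺`'s lengths) and `(C₂, δ)` at `avg U′` (coarse), `EtaRateIneqSite dB p … (C₁ + C₂) δ 0 U′` — `len_ιY`, `dist_ιY` and the
triangle inequality. [cite: Balaban1985BackgroundPropagators, Thm 3.2 (3.48) p.398, (3.132) p.422; King1986, p.664, Prop. 3.9 (3.73) p.665 (γ = 0 floor)] -/
theorem etaRateIneqSite_zero_siteKernelOfOp₂_of_bounds (hM₂ : 0 ≤ M₂) (hrepr : ∀ (v : 𝔸) (j : ι), |b.repr v j| ≤ M₂ * ‖v‖) {Xf Yf Xc Yc : Type}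
    (Of : CfgY 𝔸 (refineY x n).toKIdx → (Yf → 𝔸) →ₗ[ℂ] (Xf → 𝔸)) (Oc : CfgY 𝔸 x.toKIdx → (Yc → 𝔸) →ₗ[ℂ] (Xc → 𝔸))
    (ixf : IBondY (refineY x n).toKIdx → Xf) (iyf : IBondY (refineY x n).toKIdx → Yf) (ixc : IBondY x.toKIdx → Xc) (iyc : IBondY x.toKIdx → Yc)
    {dB : ℕ} {p C₁ C₂ δ : ℝ} {U' : CfgY 𝔸 (refineY x n).toKIdx}
    (hf : ∀ z z' : (geo9Y (refineY x n)).Site, |(siteKernelOfOp (refineY x n).toKIdx (bg9Y 𝔸 G (refineY x n)) (fun U => U) Of ixf iyf).ker U' z z'| ≤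
      C₁ * (geo9Y (refineY x n)).len z ^ (-p) * (geo9Y (refineY x n)).len z' ^ (-(dB : ℝ)) * Real.exp (-(δ * (geo9Y (refineY x n)).dist z z')))
    (hc : ∀ y y' : (geo9Y x).Site, |(siteKernelOfOp x.toKIdx (bg9Y 𝔸 G x) (fun U => U) Oc ixc iyc).ker (avg U') y y'| ≤
      C₂ * (geo9Y x).len y ^ (-p) * (geo9Y x).len y' ^ (-(dB : ℝ)) * Real.exp (-(δ * (geo9Y x).dist y y'))) :
    EtaRateIneqSite dB p (siteKernelOfOp₂ x.toKIdx n (bg9Y 𝔸 G (refineY x n)) (fun U => U) avg Of Oc ixf iyf ixc iyc) (C₁ + C₂) δ 0 U' := by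
  rw [etaRateIneqSite_zero_iff]
  intro y y'
  change _ ≤ (C₁ + C₂) * (geo9Y x).len y ^ (-p) * (geo9Y x).len y' ^ (-(dB : ℝ)) * Real.exp (-(δ * (geo9Y x).dist y y'))
  have hnn : 0 ≤ (siteKernelOfOp₂ x.toKIdx n (bg9Y 𝔸 G (refineY x n)) (fun U => U) avg Of Oc ixf iyf ixc iyc).ker U' y y' :=
    Real.iSup_nonneg fun _ => norm_nonneg _
  have h₁ : (siteKernelOfOp (refineY x n).toKIdx (bg9Y 𝔸 G (refineY x n)) (fun U => U) Of ixf iyf).ker U' (ιY x n y) (ιY x n y') ≤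
      C₁ * (geo9Y x).len y ^ (-p) * (geo9Y x).len y' ^ (-(dB : ℝ)) * Real.exp (-(δ * (geo9Y x).dist y y')) := by
    have h := (le_abs_self _).trans (hf (ιY x n y) (ιY x n y'))
    rwa [len_ιY, len_ιY, dist_ιY] at h
  have h₂ : (siteKernelOfOp x.toKIdx (bg9Y 𝔸 G (refineY x n)) avg Oc ixc iyc).ker U' y y' ≤
      C₂ * (geo9Y x).len y ^ (-p) * (geo9Y x).len y' ^ (-(dB : ℝ)) * Real.exp (-(δ * (geo9Y x).dist y y')) :=
    (le_abs_self _).trans (hc y y')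
  have hadd := siteKernelOfOp₂_ker_le_add_of_repr x.toKIdx n (bg9Y 𝔸 G (refineY x n)) (fun U => U) avg Of Oc ixf iyf ixc iyc b hM₂ hrepr U' y y'
  refine (abs_of_nonneg hnn).trans_le (hadd.trans ((add_le_add h₁ h₂).trans (le_of_eq ?_)))
  ring

/-- ★★ **THE FLOOR FACE FOR `Ksite`** (and `Kunit`'s (3.48)-shaped variant): [B9] Thm 3.2 (3.48) for the FINE member's letter at `U′` with `(C₁, δ)` AND for the COARSE
member's letter at `avg U′` with `(C₂, δ)` give N15's `EtaRateIneqSite dB p (siteKernelS₂Y G x n avg Of Oc) (C₁ + C₂) δ 0 U′` — rate exponent `γ = 0`; the η-GAIN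
`γ > 0` of [K] Prop. 3.9 is N15's content and is NOT asserted. [cite: Balaban1985BackgroundPropagators, Thm 3.2 (3.48) p.398; King1986, Prop. 3.9 (3.73) p.665 (γ = 0 floor)] -/
theorem etaRateIneqSite_zero_siteKernelS₂Y_of_bounds (hM₂ : 0 ≤ M₂) (hrepr : ∀ (v : 𝔸) (j : ι), |b.repr v j| ≤ M₂ * ‖v‖)
    (Of : BlkLetterY 𝔸 (refineY x n).toKIdx) (Oc : BlkLetterY 𝔸 x.toKIdx) {dB : ℕ} {p C₁ C₂ δ : ℝ} {U' : CfgY 𝔸 (refineY x n).toKIdx}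
    (hf : ∀ z z' : (geo9Y (refineY x n)).Site,
      |(siteKernelOfOp (refineY x n).toKIdx (bg9Y 𝔸 G (refineY x n)) (fun U => U) Of
          (β (refineY x n).hN (refineY x n).D (refineY x n).hk) (β (refineY x n).hN (refineY x n).D (refineY x n).hk)).ker U' z z'| ≤
        C₁ * (geo9Y (refineY x n)).len z ^ (-p) * (geo9Y (refineY x n)).len z' ^ (-(dB : ℝ)) * Real.exp (-(δ * (geo9Y (refineY x n)).dist z z')))
    (hc : ∀ y y' : (geo9Y x).Site, |(siteKernelOfOp x.toKIdx (bg9Y 𝔸 G x) (fun U => U) Oc (β x.hN x.D x.hk) (β x.hN x.D x.hk)).ker (avg U') y y'| ≤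
      C₂ * (geo9Y x).len y ^ (-p) * (geo9Y x).len y' ^ (-(dB : ℝ)) * Real.exp (-(δ * (geo9Y x).dist y y'))) :
    EtaRateIneqSite dB p (siteKernelS₂Y G x n avg Of Oc) (C₁ + C₂) δ 0 U' :=
  etaRateIneqSite_zero_siteKernelOfOp₂_of_bounds b hM₂ hrepr Of Oc _ _ _ _ hf hc

/-- ★★ **THE FLOOR FACE FOR THE (3.132) PAIR KERNEL**: (3.132) for the fine member at `U′` with `(C₁, δ₁)` and for the coarse member at `avg U′` with `(C₂, δ₁)`
(exponent `p`, at the record `p = 2`) give `EtaRateIneqSite dB p (idxKernelS₂Y G x n avg Of Oc) (C₁ + C₂) δ₁ 0 U′` (γ = 0; no η-gain asserted).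
[cite: Balaban1985BackgroundPropagators, (3.132) p.422; King1986, Prop. 3.9 (3.73) p.665 (γ = 0 floor)] -/
theorem etaRateIneqSite_zero_idxKernelS₂Y_of_bounds (hM₂ : 0 ≤ M₂) (hrepr : ∀ (v : 𝔸) (j : ι), |b.repr v j| ≤ M₂ * ‖v‖)
    (Of : IdxLetterY 𝔸 (refineY x n).toKIdx) (Oc : IdxLetterY 𝔸 x.toKIdx) {dB : ℕ} {p C₁ C₂ δ : ℝ} {U' : CfgY 𝔸 (refineY x n).toKIdx}
    (hf : ∀ z z' : (geo9Y (refineY x n)).Site, |(siteKernelOfOp (refineY x n).toKIdx (bg9Y 𝔸 G (refineY x n)) (fun U => U) Of id id).ker U' z z'| ≤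
      C₁ * (geo9Y (refineY x n)).len z ^ (-p) * (geo9Y (refineY x n)).len z' ^ (-(dB : ℝ)) * Real.exp (-(δ * (geo9Y (refineY x n)).dist z z')))
    (hc : ∀ y y' : (geo9Y x).Site, |(siteKernelOfOp x.toKIdx (bg9Y 𝔸 G x) (fun U => U) Oc id id).ker (avg U') y y'| ≤
      C₂ * (geo9Y x).len y ^ (-p) * (geo9Y x).len y' ^ (-(dB : ℝ)) * Real.exp (-(δ * (geo9Y x).dist y y'))) :
    EtaRateIneqSite dB p (idxKernelS₂Y G x n avg Of Oc) (C₁ + C₂) δ 0 U' :=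
  etaRateIneqSite_zero_siteKernelOfOp₂_of_bounds b hM₂ hrepr Of Oc _ _ _ _ hf hc

/-- ★ **THE FLOOR FACE FOR `Kunit`** at `θ = 1` (no gain): the (3.187)-shaped unit-lattice majorants — `|ker⁺ U′ z z′| ≤ B₁e^{−δ₀|z−z′|}` on `Λ⁺` for the fine member,
`|ker (avg U′) y y′| ≤ B₂e^{−δ₀|y−y′|}` on `Λ` for the coarse member — give `EtaRateIneqUnit (siteKernelS₂Y …) (inΛY x) (unitDistY x) (B₁ + B₂) δ₀ 1 k U′`, GIVEN the
region transfer `inΛY_ιY_iff` (§1) and the distance transfer `hD`: `|y − y′| ≤ |ι y − ι y′|` on `Λ`, carried as a HYPOTHESIS (NOT supplied here: by §1's `kLab_ιY` it is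
the `Lⁿ`-homogeneity of the torus sup-distance `tdistK`).
[K] Lemma 4.5 (4.38)'s gain `θ = L^{−1}` is N15's content, NOT asserted. [cite: Balaban1985BackgroundPropagators, Thm 3.15 (3.187) p.432; King1986, Lemma 4.5 (4.38) p.674 (θ-template)] -/
theorem etaRateIneqUnit_one_siteKernelS₂Y_of_bounds (hM₂ : 0 ≤ M₂) (hrepr : ∀ (v : 𝔸) (j : ι), |b.repr v j| ≤ M₂ * ‖v‖)
    (Of : BlkLetterY 𝔸 (refineY x n).toKIdx) (Oc : BlkLetterY 𝔸 x.toKIdx) {B₁ B₂ δ₀ : ℝ} (hB₁ : 0 ≤ B₁) (hδ : 0 ≤ δ₀) (k : ℕ)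
    {U' : CfgY 𝔸 (refineY x n).toKIdx}
    (hD : ∀ y y' : (geo9Y x).Site, inΛY x y → inΛY x y' → unitDistY x y y' ≤ unitDistY (refineY x n) (ιY x n y) (ιY x n y'))
    (hf : ∀ z z' : (geo9Y (refineY x n)).Site, inΛY (refineY x n) z → inΛY (refineY x n) z' →
      |(siteKernelOfOp (refineY x n).toKIdx (bg9Y 𝔸 G (refineY x n)) (fun U => U) Of
          (β (refineY x n).hN (refineY x n).D (refineY x n).hk) (β (refineY x n).hN (refineY x n).D (refineY x n).hk)).ker U' z z'| ≤
        B₁ * Real.exp (-(δ₀ * unitDistY (refineY x n) z z')))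
    (hc : ∀ y y' : (geo9Y x).Site, inΛY x y → inΛY x y' →
      |(siteKernelOfOp x.toKIdx (bg9Y 𝔸 G x) (fun U => U) Oc (β x.hN x.D x.hk) (β x.hN x.D x.hk)).ker (avg U') y y'| ≤ B₂ * Real.exp (-(δ₀ * unitDistY x y y'))) :
    EtaRateIneqUnit (siteKernelS₂Y G x n avg Of Oc) (inΛY x) (unitDistY x) (B₁ + B₂) δ₀ 1 k U' := by
  intro y y' hy hy'
  rw [one_pow, mul_one]
  have hnn : 0 ≤ (siteKernelS₂Y G x n avg Of Oc).ker U' y y' := Real.iSup_nonneg fun _ => norm_nonneg _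
  have h₁ : (siteKernelOfOp (refineY x n).toKIdx (bg9Y 𝔸 G (refineY x n)) (fun U => U) Of
      (β (refineY x n).hN (refineY x n).D (refineY x n).hk) (β (refineY x n).hN (refineY x n).D (refineY x n).hk)).ker U' (ιY x n y) (ιY x n y') ≤
        B₁ * Real.exp (-(δ₀ * unitDistY x y y')) :=
    ((le_abs_self _).trans (hf (ιY x n y) (ιY x n y') ((inΛY_ιY_iff x n y).2 hy) ((inΛY_ιY_iff x n y').2 hy'))).trans
      (mul_le_mul_of_nonneg_left (Real.exp_le_exp.2 (neg_le_neg (mul_le_mul_of_nonneg_left (hD y y' hy hy') hδ))) hB₁)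
  have h₂ : (siteKernelOfOp x.toKIdx (bg9Y 𝔸 G (refineY x n)) avg Oc (β x.hN x.D x.hk) (β x.hN x.D x.hk)).ker U' y y' ≤
      B₂ * Real.exp (-(δ₀ * unitDistY x y y')) :=
    (le_abs_self _).trans (hc y y' hy hy')
  have hadd := siteKernelOfOp₂_ker_le_add_of_repr x.toKIdx n (bg9Y 𝔸 G (refineY x n)) (fun U => U) avg Of Oc
    (β (refineY x n).hN (refineY x n).D (refineY x n).hk) (β (refineY x n).hN (refineY x n).D (refineY x n).hk) (β x.hN x.D x.hk) (β x.hN x.D x.hk)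
    b hM₂ hrepr U' y y'
  refine (abs_of_nonneg hnn).trans_le (hadd.trans ((add_le_add h₁ h₂).trans (le_of_eq ?_)))
  ring

end Floor

end

end Literature.MathematicalPhysics.QuantumFieldTheory.Balaban1983to89.Node00.OpsYSiteKernelPair
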